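import Literature.MathematicalPhysics.QuantumFieldTheory.Balaban1985CMP102.SectA
import Literature.MathematicalPhysics.QuantumFieldTheory.Balaban1983to89.AveragingRT

/-!
# `Summit.QuantumFields.Balaban3D.Proofs.SectAEq9` — [Balaban1985UV3] **(9)** p. 258, the Faddeev–Popov identity of the block
# axial gauge, PROVED for the spine's statement `Balaban1985CMP102.SectA.Eq9` (every contour datum, every gauge group with
# measurable multiplication and inversion) — lane `pub-balaban3d`, seat p4 (PLAN.md §3.4 «p4 ← (7)–(22)»; the spine's docstring:
# «its proof is the left- and inversion-invariance of Haar measure … left to the carrier seat»)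

HONEST FRAMING (lane PLAN.md §0, binding): see `…Proofs.SectAFirstStep`.  (9) is an elementary identity of Haar integrals;
nothing else of [Balaban1985UV3] is touched.

WHAT IS PRINTED.  p. 258 = PDF 4 L8–13 (render `…/1985-cmp102-uv-stability-3d/…-p004-x2.png`), verbatim: «The underintegral
expression in Tρ₀ is invariant with respect to gauge transformations u fixed to 1 at points of the new lattice T^{(1)}, i.e.
u(y) = 1 for y ∈ T^{(1)}. We remove this freedom in the domain Ω₁ by a simple Faddeev–Popov procedure, using the identity
Π_{y∈Ω₁^{(1)}} ∫ Π_{x∈B(y),x≠y} du(x) δ_{Ax(y)}(U^u) = 1,  (9)   δ_{Ax(y)}(U) = Π_{x∈B(y),x≠y} δ(U(Γ_{y,x})).»  The spine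
(`SectA.Eq9 cd`, typer-1) types it blockwise in the push-forward reading (cell DIVERGENCE F7): for every `U` and every coarse
site `y`, `u ↦ (U^u(Γ_{y,x}))_{x∈B(y),x≠y}` maps the product Haar measure `Π_{x} du(x)` to the product Haar measure on
`G^{B(y)∖{y}}`.

WHAT THIS FILE PROVES (no `sorry`, axioms standard): `eq9_holds : SectA.Eq9 cd` for every `cd : Setup.ContourData P j G`, under
`[MeasurableMul₂ G] [MeasurableInv G]` (measurability of the group operations — automatic for the matrix groups of
`Setting.GroupModel`, whose measurable structure is the Borel structure pulled back along `ρ`; assumed here at the level of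
the abstract interface exactly as LQB's `AveragingRT.measurePreserving_mulLeft` does).  Proof = the printed one: by gauge
covariance of the contours (`ContourData.covariant`: `U^u(Γ_{y,x}) = u(y)U(Γ_{y,x})u(x)^{−1}`) and `u(y) = 1`, the map is
`u ↦ (U(Γ_{y,x})·u(x)^{−1})_x`, coordinatewise an inversion followed by a left translation, both of which preserve Haar
measure (`HaarData.map_inv`, `HaarData.map_mul_left`); a product of measure-preserving maps preserves the product measure
(Mathlib `MeasureTheory.measurePreserving_pi`).
-/

namespace Summit.QuantumFields.Balaban3D.Proofs.SectAEq9

open Literature.MathematicalPhysics.QuantumFieldTheory.Balaban1983to89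
open Literature.MathematicalPhysics.QuantumFieldTheory.Balaban1985CMP102.SectA (AxSites blockTransf Eq9)
open _root_.MeasureTheory

variable {P : Params} {j : ℕ} {G : Type} [GaugeGroup G]

/-- The block transformation of (9) is `1` at the coarse point `y` itself («u(y) = 1 for y ∈ T^{(1)}», p. 258 L9).
[cite: Balaban1985UV3, (9) p.258] -/
theorem blockTransf_emb (y : Site P (j + 1)) (u : AxSites y → G) : blockTransf y u (emb y) = 1 := by
  unfold blockTransf
  simp

/-- On the sites `x ∈ B(y), x ≠ y` the block transformation is `u(x)`. [folklore] -/
theorem blockTransf_coe (y : Site P (j + 1)) (u : AxSites y → G) (x : AxSites y) : blockTransf y u x.1 = u x := by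
  unfold blockTransf
  simp [x.2.1, x.2.2]

/-- The integrand of (9) after gauge covariance: `U^u(Γ_{y,x}) = U(Γ_{y,x})·u(x)^{−1}` for the block transformation `u` (since
`u(y) = 1`). [cite: Balaban1985UV3, (9) p.258] -/
theorem holTo_blockTransf (cd : ContourData P j G) (U : GaugeField P j G) (y : Site P (j + 1)) (u : AxSites y → G)
    (x : AxSites y) :
    cd.holTo (GaugeField.gaugeAct (blockTransf y u) U) y x.1 = cd.holTo U y x.1 * (u x)⁻¹ := by
  rw [cd.covariant, blockTransf_emb, blockTransf_coe, one_mul]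

variable [MeasurableSpace G] [HaarData G] [MeasurableMul₂ G] [MeasurableInv G]

/-- One coordinate of (9): `g ↦ c·g^{−1}` preserves Haar measure (inversion invariance, then left invariance — the fields
`HaarData.map_inv`, `HaarData.map_mul_left`). [folklore] -/
theorem measurePreserving_const_mul_inv (c : G) :
    MeasurePreserving (fun g : G => c * g⁻¹) HaarData.haar HaarData.haar := by
  have h1 : MeasurePreserving (fun g : G => g⁻¹) HaarData.haar HaarData.haar := ⟨measurable_inv, HaarData.map_inv⟩
  have h2 : MeasurePreserving (fun g : G => c * g) HaarData.haar HaarData.haar :=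
    ⟨measurable_const_mul c, HaarData.map_mul_left c⟩
  exact h2.comp h1

/-- **(9) p. 258 = PDF 4 L8–13, PROVED** for the spine's statement: for every contour datum `cd`, every configuration `U`
and every coarse site `y`, `u ↦ (U^u(Γ_{y,x}))_{x∈B(y),x≠y}` pushes `Π_{x∈B(y),x≠y} du(x)` forward to the product Haar
measure — i.e. `∫ Π du(x) δ_{Ax(y)}(U^u) = 1` in the push-forward reading.  The printed «simple Faddeev–Popov procedure»:
covariance + `u(y) = 1` + invariance of Haar measure, coordinatewise (`measurePreserving_pi`). [cite: Balaban1985UV3, (9) p.258] -/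
theorem eq9_holds (cd : ContourData P j G) : Eq9 cd := by
  intro U y
  have hfun : (fun u : AxSites y → G => fun x : AxSites y =>
        cd.holTo (GaugeField.gaugeAct (blockTransf y u) U) y x.1)
      = fun u x => cd.holTo U y x.1 * (u x)⁻¹ := by
    funext u x
    exact holTo_blockTransf cd U y u x
  rw [hfun]
  exact (measurePreserving_pi (fun _ : AxSites y => (HaarData.haar : Measure G)) (fun _ => HaarData.haar)
    (f := fun x g => cd.holTo U y x.1 * g⁻¹) (fun x => measurePreserving_const_mul_inv (cd.holTo U y x.1))).map_eq

end Summit.QuantumFields.Balaban3D.Proofs.SectAEq9
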